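import Summits.QuantumFields.YangMills.Theorems.BalabanUVNodesN15NeumannCubeLiftSpacing
import HarnessLib

/-!
# Route «BalabanUVNodes» (K3⁷), node N15 = NE2, -a lane, PROGRAMME P file P-IIf: DESCENDING OPERATORS BEHIND THE LIFTED CUBE — the nonlocal part `aQ*Q − ∂Π∂*` of `Δ_a` descends
# along `π^*`; rows and two-grid η-defect rows of `χ_□ ∘ T₁ ∘ G^{↑}(□)` for descending `T₁` are programme N's rows TRANSPLANTED (N-IIi ∕ N-IIk on the torus of record)

Cell `pub-ymgap`, seat `pub-ymgap-dag-n15-a` (KNIT-BY-NAME, g20; D-0062; chair R424 venue; `bears_on: R4∕N15`); `--kind proof --supports stmt-QuantumFields-20544 --as helper`.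
Sequel of P-IIb∕c∕d∕e.  For dag-n15-c's torus-of-record edition of FILE 71∕73 (η-defect of the glued parametrix from cut-row defects): their third term is `M_{h_k} ∘ (aQ*Q − ∂Π∂*) ∘ G_k(□_k)`
(FILE 70 `deltaOp M n a = lapOp … + (a • (qvAdjRe ∘ qvRe) + (−landauRe))`); on the torus of record `G_k(□_k) = liftCubeG`, and `aQ*Q − ∂Π∂*` DESCENDS, so the rows are TRANSPLANTS of
programme N's rows on the doubled-cube torus — no new convolution (P-IIe's (β′) is for operators that do NOT descend).

WHAT.  Torus pair `π : Tor (fine n M) → Tor (fine n M′)`, `M′_ν ∣ M_ν`, `π^* = pullVR n hM`.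
§31 DESCENTS: ★ `symbOp_sLapDir_comp_pullVR`, ★ `symbOp_sLap_comp_pullVR` (the local Laplacian `ρ(sLap)`), ★★ `smul_qvAdjRe_comp_qvRe_comp_pullVR` (`aQ*Q ∘ π^* = π^* ∘ aQ′*Q′`, from
`Δ_a = ρ(sLap) − V + aQ*Q` (part 39 `deltaOp_eq`) and the descents of `Δ_a` (P-Ib), `ρ(sLap)`, `V` (P-IIb)), ★★ `nonlocalRe_comp_pullVR` — IN dag-n15-c's SYNTAX:
`(a • (qvAdjRe M n ∘ₗ qvRe M n) + (-landauRe M n)) ∘ₗ π^* = π^* ∘ₗ (a • (qvAdjRe M′ n ∘ₗ qvRe M′ n) + (-landauRe M′ n))`.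
§32 TRANSFERS for a descending `T₁` (`T₁ ∘ₗ π^* = π^* ∘ₗ T₁ₛ`): ★ `mulOp_chiCube_comp_comp_liftCubeG_of_comm` (`χ_□ ∘ T₁ ∘ G^{↑}(□) = transplant W π (T₁ₛ ∘ G(□′))`), ★★
`hasMaj_chiCube_comp_liftCubeG_of_comm` (family, any spacing `n`: programme N's cut row of `χ′_□ ∘ T₁ₛ ∘ G(□′)` ⟹ the same letter for `χ_□ ∘ T₁ ∘ G^{↑}(□)` on `M_ν = 2L^{m_T}`), ★★★
`hasMaj_idef_chiCube_comp_liftCubeG_of_comm` (family, spacings `L^k` ⊂ `L^r·L^k`: the small pair's η-defect row `𝔇(χ′T₁ₛ′G′(□′), χT₁ₛG(□′)) ≤ 1_□1_□·m·e^{−δd′}` — e.g. N-IIk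
`hasMaj_idef_chiCube_comp_neumannCubeG_of` — ⟹ `𝔇(χ′T₁′G′^{↑}, χT₁G^{↑}) ≤ 1_□1_□·m·e^{−δd}` on the torus of record, SAME `m, δ`, UNIFORM in `m_T`).
HONEST FRAMING.  Algebra of descents + P-IIc∕P-IId's transfer theorems; no new analytic estimate; `U ≡ 1` torus MODEL of [B5] §1; nothing of [B6] (2.38)–(2.40) ∕ [B9] Thm 3.14 asserted; N15 NOT
discharged (object-bound; NE2⁺ NOT PRINTED); counts UNMOVED (typed 28∕28 · discharged 5∕27); finite tori per index — NOT continuum ∕ ℝ⁴ ∕ OS ∕ mass gap ∕ Clay.  Theorems only (0 def).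
-/

noncomputable section

open scoped BigOperators Matrix
open Finset

namespace Summit.QuantumFields.YangMills.BalabanUVNodes.N15.TwoGrid

open Literature.MathematicalPhysics.QuantumFieldTheory.Balaban1983to89
open Literature.MathematicalPhysics.QuantumFieldTheory.Balaban1983to89.B5Prop11Plancherel (Tor fine unitVec)
open Literature.MathematicalPhysics.QuantumFieldTheory.Balaban1983to89.B5Block118 (tstep up upHom iota bpt)
open Literature.MathematicalPhysics.QuantumFieldTheory.Balaban1983to89.B5SiteBridgeP12 (MP)
open Literature.MathematicalPhysics.QuantumFieldTheory.Balaban1983to89.B6Prop26Gluing (mulOp mulOp_apply ind ind_nonneg ind_le_one)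
open Literature.MathematicalPhysics.QuantumFieldTheory.Balaban1983to89.B6Prop26ReachTransplant (restrictOp extendOp transplant)
open Literature.MathematicalPhysics.QuantumFieldTheory.King1986.Torus (blockOf tdistT)
open Literature.MathematicalPhysics.QuantumFieldTheory.Balaban1983to89.T4EtaRateDefect (idef)
open Literature.MathematicalPhysics.QuantumFieldTheory.Balaban1983to89.T4EtaRateCoeffDefect (pull pull_apply)
open Literature.MathematicalPhysics.QuantumFieldTheory.Balaban1983to89.B11SectG (BlockNorm HasMaj)
open Literature.MathematicalPhysics.QuantumFieldTheory.Balaban1983to89.B6UnitTorusCarrier (unitTorusGeo)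
open Summit.QuantumFields.YangMills.BalabanUVNodes.N15.VectorPiece (kingPr kingPrV blkFine)

variable {d : ℕ}

/-! ## §31 The nonlocal part of `Δ_a` descends along `π^*` -/

section Descent

variable (n : ℕ) [NeZero n] {M M' : Fin (d + 1) → ℕ} [∀ μ, NeZero (M μ)] [∀ μ, NeZero (M' μ)] (hM : ∀ μ, M' μ ∣ M μ)

omit [∀ μ, NeZero (M μ)] in
/-- ★ the directional Laplacian descends: `ρ_M(sLapDir ν c) ∘ π^* = π^* ∘ ρ_{M′}(sLapDir ν c)`. [cite: Balaban1984PropagatorsI, (1.21) p.21] -/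
theorem symbOp_sLapDir_comp_pullVR (ν : Fin (d + 1)) (cc : ℝ) :
    symbOp M n (sLapDir M n ν cc) ∘ₗ pullVR n hM = pullVR n hM ∘ₗ symbOp M' n (sLapDir M' n ν cc) := by
  refine LinearMap.ext fun A => funext fun b => ?_
  obtain ⟨x, μ⟩ := b
  rw [LinearMap.comp_apply, LinearMap.comp_apply, symbOp_sLapDir_apply, pullVR_apply, pullVR_apply, pullVR_apply, pullVR_apply, symbOp_sLapDir_apply,
    torRed_add_unitVec, torRed_sub_unitVec]

omit [∀ μ, NeZero (M μ)] in
/-- ★ the local Laplacian descends: `ρ_M(sLap c) ∘ π^* = π^* ∘ ρ_{M′}(sLap c)`. [cite: Balaban1984PropagatorsI, (1.21) p.21] -/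
theorem symbOp_sLap_comp_pullVR (cc : ℝ) : symbOp M n (sLap M n cc) ∘ₗ pullVR n hM = pullVR n hM ∘ₗ symbOp M' n (sLap M' n cc) := by
  rw [sLap, sLap, map_sum, map_sum, fsum_comp, comp_fsum]
  exact Finset.sum_congr rfl fun ν _ => symbOp_sLapDir_comp_pullVR n hM ν cc

/-- ★★ **THE AVERAGING TERM `aQ*Q` DESCENDS**: `(a·Q*Q)_M ∘ π^* = π^* ∘ (a·Q*Q)_{M′}` — from `Δ_a = ρ(sLap) − V + aQ*Q` and the descents of `Δ_a`, `ρ(sLap)`, `V`.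
[cite: Balaban1984PropagatorsI, (1.18) p.20, (1.69)–(1.73) pp.29–30] -/
theorem smul_qvAdjRe_comp_qvRe_comp_pullVR (a : ℝ) :
    (a • (qvAdjRe M n ∘ₗ qvRe M n)) ∘ₗ pullVR n hM = pullVR n hM ∘ₗ (a • (qvAdjRe M' n ∘ₗ qvRe M' n)) := by
  have e : a • (qvAdjRe M n ∘ₗ qvRe M n) = deltaOp M n a - symbOp M n (sLap M n n) + landauRe M n := by
    rw [deltaOp_eq M n a]; abel
  have e' : a • (qvAdjRe M' n ∘ₗ qvRe M' n) = deltaOp M' n a - symbOp M' n (sLap M' n n) + landauRe M' n := by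
    rw [deltaOp_eq M' n a]; abel
  rw [e, e', LinearMap.add_comp, LinearMap.sub_comp, LinearMap.comp_add, LinearMap.comp_sub, deltaOp_comp_pullVR n hM a, symbOp_sLap_comp_pullVR n hM,
    landauRe_comp_pullVR n hM]

/-- ★★ **THE NONLOCAL PART OF `Δ_a` DESCENDS** (dag-n15-c's syntax, FILE 70 `deltaOp = lapOp … + (a • (qvAdjRe ∘ qvRe) + (−landauRe))`):
`(a·Q*Q − ∂Π∂*)_M ∘ π^* = π^* ∘ (a·Q*Q − ∂Π∂*)_{M′}`. [cite: Balaban1984PropagatorsI, (1.69)–(1.73) pp.29–30; Balaban1984PropagatorsII, (2.91)–(2.93) p.239] -/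
theorem nonlocalRe_comp_pullVR (a : ℝ) :
    (a • (qvAdjRe M n ∘ₗ qvRe M n) + (-landauRe M n)) ∘ₗ pullVR n hM = pullVR n hM ∘ₗ (a • (qvAdjRe M' n ∘ₗ qvRe M' n) + (-landauRe M' n)) := by
  rw [LinearMap.add_comp, LinearMap.comp_add, smul_qvAdjRe_comp_qvRe_comp_pullVR n hM a, LinearMap.neg_comp, LinearMap.comp_neg, landauRe_comp_pullVR n hM]

variable (c : Tor M) (S : ℕ)

/-- ★ a descending operator slips inside the cut lift: `χ_□ ∘ T₁ ∘ G^{↑}(□) = transplant W π (T₁ₛ ∘ G(□′))`. [cite: Balaban1984PropagatorsII, (2.90)–(2.91) p.239] -/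
theorem mulOp_chiCube_comp_comp_liftCubeG_of_comm (a : ℝ) {T₁ : Module.End ℝ (Tor (fine n M) × Fin (d + 1) → ℝ)} {T₁s : Module.End ℝ (Tor (fine n M') × Fin (d + 1) → ℝ)}
    (hT : T₁ ∘ₗ pullVR n hM = pullVR n hM ∘ₗ T₁s) :
    mulOp (chiCube M n c S) ∘ₗ T₁ ∘ₗ liftCubeG n hM c S a = transplant (cubeW n c S) (redBond n hM) (T₁s ∘ₗ neumannCubeG M' n (torRed hM c) S a) := by
  rw [liftCubeG_eq_liftOp, comp_liftOp_of_comm n hM c S hT, mulOp_chiCube_comp_liftOp]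

end Descent

/-! ## §32 Rows and η-defect rows of `χ_□ ∘ T₁ ∘ G^{↑}(□)` for descending `T₁` on the torus family of record: programme N's rows transplanted -/

section Family

variable {L : ℕ} [NeZero L]

omit [NeZero L] in
/-- ★★ **A DESCENDING OPERATOR BEHIND THE LIFTED CUBE, CUT — ANY SPACING `n`** (torus of record `M_ν = 2L^{m_T}`, cube torus `2L^s`, `s ≤ m_T`): if `T₁ ∘ π^* = π^* ∘ T₁ₛ` and programme N
gives `χ′_□ ∘ T₁ₛ ∘ G(□′) ≤ 1_{□′}1_{□′}βe^{−δd′}` on the cube torus, then `χ_□ ∘ T₁ ∘ G^{↑}(□) ≤ 1_□1_□βe^{−δd}` on the torus of record — same `β, δ`, UNIFORM in `m_T`.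
[cite: Balaban1984PropagatorsII, (2.133) p.247 (shape), p.238 (T_□), (2.90)–(2.91) p.239] -/
theorem hasMaj_chiCube_comp_liftCubeG_of_comm (hL : Odd L ∧ 1 < L) {s mT k : ℕ} (hs : s ≤ mT) (n : ℕ) [NeZero n] (c : Tor (MP (paramsOf d L mT k hL))) (a : ℝ)
    {T₁ : Module.End ℝ (Tor (fine n (MP (paramsOf d L mT k hL))) × Fin (d + 1) → ℝ)} {T₁s : Module.End ℝ (Tor (fine n (MP (paramsOf d L s k hL))) × Fin (d + 1) → ℝ)}
    (hT : T₁ ∘ₗ pullVR n (MP_dvd_MP hL hs k) = pullVR n (MP_dvd_MP hL hs k) ∘ₗ T₁s) {β δ : ℝ} (hβ : 0 ≤ β)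
    (hX : HasMaj (BlockNorm.ofBlocks (unitTorusGeo L k (MP (paramsOf d L s k hL))) (fun i : Tor (fine n (MP (paramsOf d L s k hL))) × Fin (d + 1) => blockOf n (MP (paramsOf d L s k hL)) i.1))
      (BlockNorm.ofBlocks (unitTorusGeo L k (MP (paramsOf d L s k hL))) (fun i : Tor (fine n (MP (paramsOf d L s k hL))) × Fin (d + 1) => blockOf n (MP (paramsOf d L s k hL)) i.1))
      (mulOp (chiCube (MP (paramsOf d L s k hL)) n (torRed (MP_dvd_MP hL hs k) c) (L ^ s)) ∘ₗ T₁s ∘ₗ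
        neumannCubeG (MP (paramsOf d L s k hL)) n (torRed (MP_dvd_MP hL hs k) c) (L ^ s) a)
      (fun y y' => ind ((cubeBlocks (MP (paramsOf d L s k hL)) (torRed (MP_dvd_MP hL hs k) c) (L ^ s) : Finset _) : Set _) y *
        ind ((cubeBlocks (MP (paramsOf d L s k hL)) (torRed (MP_dvd_MP hL hs k) c) (L ^ s) : Finset _) : Set _) y' *
        (β * Real.exp (-(δ * tdistT (MP (paramsOf d L s k hL)) y y'))))) :
    HasMaj (BlockNorm.ofBlocks (unitTorusGeo L k (MP (paramsOf d L mT k hL))) (fun i : Tor (fine n (MP (paramsOf d L mT k hL))) × Fin (d + 1) => blockOf n (MP (paramsOf d L mT k hL)) i.1))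
      (BlockNorm.ofBlocks (unitTorusGeo L k (MP (paramsOf d L mT k hL))) (fun i : Tor (fine n (MP (paramsOf d L mT k hL))) × Fin (d + 1) => blockOf n (MP (paramsOf d L mT k hL)) i.1))
      (mulOp (chiCube (MP (paramsOf d L mT k hL)) n c (L ^ s)) ∘ₗ T₁ ∘ₗ liftCubeG n (MP_dvd_MP hL hs k) c (L ^ s) a)
      (fun y y' => ind ((cubeBlocks (MP (paramsOf d L mT k hL)) c (L ^ s) : Finset _) : Set _) y *
        ind ((cubeBlocks (MP (paramsOf d L mT k hL)) c (L ^ s) : Finset _) : Set _) y' *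
        (β * Real.exp (-(δ * tdistT (MP (paramsOf d L mT k hL)) y y')))) := by
  exact (hasMaj_transplant_cube_family_spacing hL hs n c _ hβ hX).congr fun f =>
    (LinearMap.congr_fun (mulOp_chiCube_comp_comp_liftCubeG_of_comm n (MP_dvd_MP hL hs k) c (L ^ s) a hT) f).symm

/-- ★★★ **THE TWO-GRID η-DEFECT OF `χ_□ ∘ T₁ ∘ G^{↑}(□)` FOR DESCENDING `T₁` ON THE TORUS FAMILY OF RECORD** (spacings `L^k` and `L^r·L^k`, King's prolongation on both sides, `s ≤ m_T`):
if `T₁ ∘ π^* = π^* ∘ T₁ₛ` and `T₁′ ∘ π′^* = π′^* ∘ T₁ₛ′`, then the cube torus's η-defect row `𝔇(χ′T₁ₛ′G′(□′), χT₁ₛG(□′)) ≤ 1_{□′}1_{□′}·m·e^{−δd′}` (e.g. N-IIk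
`hasMaj_idef_chiCube_comp_neumannCubeG_of` with `T₁ₛ = aQ*Q − ∂Π∂*`, descending by `nonlocalRe_comp_pullVR`) gives `𝔇(χ′T₁′G′^{↑}(□), χT₁G^{↑}(□)) ≤ 1_□1_□·m·e^{−δd}` on the torus of
record — SAME `m, δ`, UNIFORM in the volume `m_T`.
[cite: Balaban1985BackgroundPropagators, Thm 3.14 pp.426–427 (difference template), (3.42) p.397 (shape); Balaban1984PropagatorsII, (2.90)–(2.91) p.239, (2.133) p.247] -/
theorem hasMaj_idef_chiCube_comp_liftCubeG_of_comm (hL : Odd L ∧ 1 < L) {s mT k r : ℕ} (hs : s ≤ mT) (c : Tor (MP (paramsOf d L mT k hL))) (a : ℝ)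
    {T₁ : Module.End ℝ (Tor (fine (L ^ k) (MP (paramsOf d L mT k hL))) × Fin (d + 1) → ℝ)}
    {T₁' : Module.End ℝ (Tor (fine (L ^ r * L ^ k) (MP (paramsOf d L mT k hL))) × Fin (d + 1) → ℝ)}
    {T₁s : Module.End ℝ (Tor (fine (L ^ k) (MP (paramsOf d L s k hL))) × Fin (d + 1) → ℝ)}
    {T₁s' : Module.End ℝ (Tor (fine (L ^ r * L ^ k) (MP (paramsOf d L s k hL))) × Fin (d + 1) → ℝ)}
    (hT : T₁ ∘ₗ pullVR (L ^ k) (MP_dvd_MP hL hs k) = pullVR (L ^ k) (MP_dvd_MP hL hs k) ∘ₗ T₁s)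
    (hT' : T₁' ∘ₗ pullVR (L ^ r * L ^ k) (MP_dvd_MP hL hs k) = pullVR (L ^ r * L ^ k) (MP_dvd_MP hL hs k) ∘ₗ T₁s') {m δ : ℝ} (hm : 0 ≤ m)
    (hX : HasMaj (BlockNorm.ofBlocks (unitTorusGeo L k (MP (paramsOf d L s k hL))) (blkFine L k (MP (paramsOf d L s k hL))))
      (BlockNorm.ofBlocks (unitTorusGeo L k (MP (paramsOf d L s k hL)))
        (fun i : Tor (fine (L ^ r * L ^ k) (MP (paramsOf d L s k hL))) × Fin (d + 1) => blockOf (L ^ r * L ^ k) (MP (paramsOf d L s k hL)) i.1))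
      (idef (pull (kingPrV L k r (MP (paramsOf d L s k hL)))) (pull (kingPrV L k r (MP (paramsOf d L s k hL))))
        (mulOp (chiCube (MP (paramsOf d L s k hL)) (L ^ r * L ^ k) (torRed (MP_dvd_MP hL hs k) c) (L ^ s)) ∘ₗ T₁s' ∘ₗ
          neumannCubeG (MP (paramsOf d L s k hL)) (L ^ r * L ^ k) (torRed (MP_dvd_MP hL hs k) c) (L ^ s) a)
        (mulOp (chiCube (MP (paramsOf d L s k hL)) (L ^ k) (torRed (MP_dvd_MP hL hs k) c) (L ^ s)) ∘ₗ T₁s ∘ₗ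
          neumannCubeG (MP (paramsOf d L s k hL)) (L ^ k) (torRed (MP_dvd_MP hL hs k) c) (L ^ s) a))
      (fun y y' => ind ((cubeBlocks (MP (paramsOf d L s k hL)) (torRed (MP_dvd_MP hL hs k) c) (L ^ s) : Finset _) : Set _) y *
        ind ((cubeBlocks (MP (paramsOf d L s k hL)) (torRed (MP_dvd_MP hL hs k) c) (L ^ s) : Finset _) : Set _) y' *
        (m * Real.exp (-(δ * tdistT (MP (paramsOf d L s k hL)) y y'))))) :
    HasMaj (BlockNorm.ofBlocks (unitTorusGeo L k (MP (paramsOf d L mT k hL))) (blkFine L k (MP (paramsOf d L mT k hL))))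
      (BlockNorm.ofBlocks (unitTorusGeo L k (MP (paramsOf d L mT k hL)))
        (fun i : Tor (fine (L ^ r * L ^ k) (MP (paramsOf d L mT k hL))) × Fin (d + 1) => blockOf (L ^ r * L ^ k) (MP (paramsOf d L mT k hL)) i.1))
      (idef (pull (kingPrV L k r (MP (paramsOf d L mT k hL)))) (pull (kingPrV L k r (MP (paramsOf d L mT k hL))))
        (mulOp (chiCube (MP (paramsOf d L mT k hL)) (L ^ r * L ^ k) c (L ^ s)) ∘ₗ T₁' ∘ₗ liftCubeG (L ^ r * L ^ k) (MP_dvd_MP hL hs k) c (L ^ s) a)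
        (mulOp (chiCube (MP (paramsOf d L mT k hL)) (L ^ k) c (L ^ s)) ∘ₗ T₁ ∘ₗ liftCubeG (L ^ k) (MP_dvd_MP hL hs k) c (L ^ s) a))
      (fun y y' => ind ((cubeBlocks (MP (paramsOf d L mT k hL)) c (L ^ s) : Finset _) : Set _) y *
        ind ((cubeBlocks (MP (paramsOf d L mT k hL)) c (L ^ s) : Finset _) : Set _) y' *
        (m * Real.exp (-(δ * tdistT (MP (paramsOf d L mT k hL)) y y')))) := by
  have h := hasMaj_idef_transplant_cube_family (d := d) hL (r := r) hs c _ _ hm hX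
  have e₂ := mulOp_chiCube_comp_comp_liftCubeG_of_comm (L ^ r * L ^ k) (MP_dvd_MP hL hs k) c (L ^ s) a hT'
  have e₁ := mulOp_chiCube_comp_comp_liftCubeG_of_comm (L ^ k) (MP_dvd_MP hL hs k) c (L ^ s) a hT
  have E := congrArg₂ (idef (pull (kingPrV L k r (MP (paramsOf d L mT k hL)))) (pull (kingPrV L k r (MP (paramsOf d L mT k hL))))) e₂ e₁
  exact h.congr fun μ => (LinearMap.congr_fun E μ).symm

end Family

end Summit.QuantumFields.YangMills.BalabanUVNodes.N15.TwoGrid
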